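import Mathlib
import HarnessLib
import Summits.CriticalPhenomena.PercolationContinuityZ3.Theses.PercTreeValue
import Literature.Probability.Percolation.TwoPointFunction
import Literature.Probability.Percolation.PercolationProofs

/-!
# `stub_cruxOfSeamCS` of line `SketchIdeator2` (crux `TetrahedronDisjointCoexistence`,
# stmt-CriticalPhenomena-7798): the crux from the cut census via Cauchy–Schwarz

Registered stub `stub_cruxOfSeamCS` of the lead's skeleton
`Cruxes/TetrahedronDisjointCoexistence/Lines/SketchIdeator2.lean`, landed DEF-FREE over tree
declarations.

With `P = P_{p_c(ℤ³)}`, `a_r = (r,r,0)`, `b_r = (r,0,r)`, `c_r = (0,r,r)`, the disjoint-coexistence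
event `D_r = {0 ↔ a_r} ∩ {b_r ↔ c_r} ∩ {0 ↔ b_r}ᶜ`, the seam count
`N_r(ω) = #{lattice edges with one end in C_ω(0) and the other in C_ω(b_r)}` (written as a `tsum`
of indicators over `Sym2 (Site 3)`) and `T_r = τ(0,a_r) τ(b_r,c_r)`, the hypothesis (cut census)
says `E[N_r²; D_r] · T_r ≤ C · E[N_r; D_r]²` with `0 < E[N_r; D_r] < ∞` for `r ≥ r₀` and a finite
constant `C`.  Cauchy–Schwarz on the restricted measure gives `E[N_r; D_r]² ≤ P(D_r) · E[N_r²; D_r]`,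
whence `T_r ≤ C · P(D_r)` (the degenerate cases `E[N_r²; D_r] ∈ {0, ∞}` are excluded by
`0 < E[N_r; D_r] < ∞` when `T_r > 0`, and `T_r = 0` is trivial), i.e. the crux with
`δ = 1 / max C.toReal 1`.  No percolation input beyond measurability of `{x ↔ y}`
(`measurableSet_openConn_holds`).
-/

noncomputable section

namespace Summit.CriticalPhenomena.PercolationContinuityZ3.Theorems.TetrahedronDisjointCoexistence

open MeasureTheory
open Literature.Probability.Percolation Literature.Probability.LatticeModels
open scoped ENNReal

/-- **Cauchy–Schwarz for `lintegral`** in the form `(∫ f)² ≤ μ(univ) · ∫ f²` (Hölder with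
exponents `2, 2` against the constant function `1`). -/
theorem seamCS_lintegral_sq_le {Ω : Type*} [MeasurableSpace Ω] (μ : Measure Ω) (f : Ω → ℝ≥0∞)
    (hf : AEMeasurable f μ) :
    (∫⁻ x, f x ∂μ) ^ 2 ≤ μ Set.univ * ∫⁻ x, f x ^ 2 ∂μ := by
  have h := ENNReal.lintegral_mul_le_Lp_mul_Lq μ Real.HolderConjugate.two_two hf
    (g := fun _ => 1) aemeasurable_const
  simp only [Pi.mul_apply, mul_one, lintegral_const, ENNReal.rpow_two, one_pow, one_mul] at h
  calc (∫⁻ x, f x ∂μ) ^ 2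
      ≤ ((∫⁻ x, f x ^ 2 ∂μ) ^ (1 / 2 : ℝ) * μ Set.univ ^ (1 / 2 : ℝ)) ^ 2 := by gcongr
    _ = μ Set.univ * ∫⁻ x, f x ^ 2 ∂μ := by
      rw [← ENNReal.mul_rpow_of_nonneg _ _ (by norm_num : (0 : ℝ) ≤ 1 / 2), ← ENNReal.rpow_two,
        ← ENNReal.rpow_mul]
      norm_num [mul_comm]

/-- The event "the pair `e` is an `E`-edge joining `C(x)` to `C(y)`" is measurable (a countable
union over the two endpoints of connection events). -/
theorem seamCS_measurableSet_seamEdge {V : Type*} [Countable V] (E : Set (Sym2 V)) (x y : V)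
    (e : Sym2 V) :
    MeasurableSet {ω : BondConfig V | e ∈ E ∧ ∃ u v : V, e = s(u, v) ∧ u ∈ openCluster ω x ∧
      v ∈ openCluster ω y} := by
  have h : {ω : BondConfig V | e ∈ E ∧ ∃ u v : V, e = s(u, v) ∧ u ∈ openCluster ω x ∧
      v ∈ openCluster ω y} =
        {_ω | e ∈ E} ∩ ⋃ u : V, ⋃ v : V, ({_ω | e = s(u, v)} ∩ (openConn x u ∩ openConn y v)) := by
    ext ω
    simp only [Set.mem_setOf_eq, Set.mem_inter_iff, Set.mem_iUnion, openConn, openCluster]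
  rw [h]
  exact (MeasurableSet.const _).inter (MeasurableSet.iUnion fun u => MeasurableSet.iUnion fun v =>
    (MeasurableSet.const _).inter
      ((measurableSet_openConn_holds x u).inter (measurableSet_openConn_holds y v)))

/-- The seam count `N(ω) = Σ'_e 𝟙{e is an E-edge joining C_ω(x) to C_ω(y)}` is measurable. -/
theorem seamCS_measurable_seamCount {V : Type*} [Countable V] (E : Set (Sym2 V)) (x y : V) :
    Measurable fun ω : BondConfig V => ∑' e : Sym2 V,
      ({e | e ∈ E ∧ ∃ u v : V, e = s(u, v) ∧ u ∈ openCluster ω x ∧ v ∈ openCluster ω y} :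
        Set (Sym2 V)).indicator (fun _ => (1 : ℝ≥0∞)) e := by
  classical
  refine Measurable.tsum fun e => ?_
  simp only [Set.indicator_apply, Set.mem_setOf_eq]
  exact Measurable.ite (seamCS_measurableSet_seamEdge E x y e) measurable_const measurable_const

/-- `ℝ≥0∞` bookkeeping: from Cauchy–Schwarz `I₁² ≤ P(D) · I₂`, the census `I₂ · T ≤ C · I₁²`,
`0 < I₁ < ∞`, `C < ∞` and `T > 0`, conclude `T ≤ C · P(D)` (the cases `I₂ = ∞`, `I₂ = 0` are
contradictory, otherwise cancel `I₂`). -/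
theorem seamCS_ofReal_le_of_moments {I₁ I₂ PD C : ℝ≥0∞} {T : ℝ} (hcs : I₁ ^ 2 ≤ PD * I₂)
    (h1 : I₂ * ENNReal.ofReal T ≤ C * I₁ ^ 2) (h2 : I₁ ≠ ⊤) (h3 : I₁ ≠ 0) (hC : C ≠ ⊤)
    (hT : 0 < T) : ENNReal.ofReal T ≤ C * PD := by
  have hT' : ENNReal.ofReal T ≠ 0 := (ENNReal.ofReal_pos.2 hT).ne'
  have hI2top : I₂ ≠ ⊤ := by
    intro h
    rw [h, ENNReal.top_mul hT', top_le_iff] at h1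
    exact ENNReal.mul_ne_top hC (ENNReal.pow_ne_top h2) h1
  have hI20 : I₂ ≠ 0 := by
    intro h
    rw [h, mul_zero, nonpos_iff_eq_zero, pow_eq_zero_iff two_ne_zero] at hcs
    exact h3 hcs
  have : I₂ * ENNReal.ofReal T ≤ I₂ * (C * PD) :=
    calc I₂ * ENNReal.ofReal T ≤ C * I₁ ^ 2 := h1
      _ ≤ C * (PD * I₂) := by gcongr
      _ = I₂ * (C * PD) := by ring
  exact (ENNReal.mul_le_mul_iff_right hI20 hI2top).1 this

/-- **Abstract form of the stub.** For a finite measure `P`, events `D r`, a.e.-measurable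
`N r ≥ 0` and reals `T r ≥ 0`: if `E[N_r²; D_r] · T_r ≤ C · E[N_r; D_r]²` with
`0 < E[N_r; D_r] < ∞` for `r ≥ r₀` and `C < ∞`, then `δ · T_r ≤ P(D_r)` for `r ≥ r₀` with
`δ = 1 / max C.toReal 1 > 0` (Cauchy–Schwarz `E[N;D]² ≤ P(D) E[N²;D]`). -/
theorem seamCS_crux_of_moments {Ω : Type*} [MeasurableSpace Ω] {P : Measure Ω} [IsFiniteMeasure P]
    {D : ℕ → Set Ω} {N : ℕ → Ω → ℝ≥0∞} {T : ℕ → ℝ}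
    (hCS : ∃ C : ℝ≥0∞, C ≠ ⊤ ∧ ∃ r₀ : ℕ, ∀ r : ℕ, r₀ ≤ r →
      (∫⁻ ω in D r, N r ω ^ 2 ∂P) * ENNReal.ofReal (T r) ≤ C * (∫⁻ ω in D r, N r ω ∂P) ^ 2 ∧
      (∫⁻ ω in D r, N r ω ∂P) ≠ ⊤ ∧ (∫⁻ ω in D r, N r ω ∂P) ≠ 0)
    (hT : ∀ r, 0 ≤ T r) (hN : ∀ r, AEMeasurable (N r) (P.restrict (D r))) :
    ∃ δ : ℝ, 0 < δ ∧ ∃ r₀ : ℕ, ∀ r : ℕ, r₀ ≤ r → δ * T r ≤ P.real (D r) := by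
  obtain ⟨C, hC, r₀, hr₀⟩ := hCS
  refine ⟨1 / max C.toReal 1, by positivity, r₀, fun r hr => ?_⟩
  obtain ⟨h1, h2, h3⟩ := hr₀ r hr
  have hMpos : (0 : ℝ) < max C.toReal 1 := by positivity
  -- Cauchy–Schwarz on the restricted measure
  have hcs : (∫⁻ ω in D r, N r ω ∂P) ^ 2 ≤ P (D r) * ∫⁻ ω in D r, N r ω ^ 2 ∂P := by
    have := seamCS_lintegral_sq_le (P.restrict (D r)) (N r) (hN r)
    rwa [Measure.restrict_apply_univ] at this
  rcases (hT r).eq_or_lt with hT0 | hTpos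
  · -- `T r = 0`: trivial
    rw [← hT0, mul_zero]
    exact measureReal_nonneg
  · have key : ENNReal.ofReal (T r) ≤ C * P (D r) :=
      seamCS_ofReal_le_of_moments hcs h1 h2 h3 hC hTpos
    have hfin : C * P (D r) ≠ ⊤ := ENNReal.mul_ne_top hC (measure_ne_top P _)
    rw [ENNReal.ofReal_le_iff_le_toReal hfin, ENNReal.toReal_mul] at key
    rw [measureReal_def]
    have hle : T r ≤ max C.toReal 1 * (P (D r)).toReal :=
      key.trans (mul_le_mul_of_nonneg_right (le_max_left _ _) ENNReal.toReal_nonneg)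
    calc 1 / max C.toReal 1 * T r ≤ 1 / max C.toReal 1 * (max C.toReal 1 * (P (D r)).toReal) :=
          mul_le_mul_of_nonneg_left hle (by positivity)
      _ = (P (D r)).toReal := by rw [one_div, inv_mul_cancel_left₀ hMpos.ne']

/-- **Stub `stub_cruxOfSeamCS` (line SketchIdeator2): the crux from the cut census.**
With `P = P_{p_c(ℤ³)}`, `D_r = {0 ↔ a_r} ∩ {b_r ↔ c_r} ∩ {0 ↔ b_r}ᶜ`, the seam count
`N_r(ω) = Σ'_e 𝟙{e ∈ E(ℤ³), e = s(u,v), u ∈ C_ω(0), v ∈ C_ω(b_r)}` and `T_r = τ(0,a_r) τ(b_r,c_r)`: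
if `E[N_r²; D_r] · T_r ≤ C · E[N_r; D_r]²` with `0 < E[N_r; D_r] < ∞` (`r ≥ r₀`, `C < ∞`), then
`TetrahedronDisjointCoexistence` holds (with `δ = 1 / max C.toReal 1`): Cauchy–Schwarz
`E[N_r; D_r]² ≤ P(D_r) · E[N_r²; D_r]` (`seamCS_lintegral_sq_le`) gives `T_r ≤ C · P(D_r)`
(`seamCS_crux_of_moments`); the seam count is measurable (`seamCS_measurable_seamCount`). -/
theorem stub_cruxOfSeamCS
    (hCS : ∃ C : ENNReal, C ≠ ⊤ ∧ ∃ r₀ : ℕ, ∀ r : ℕ, r₀ ≤ r →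
      (∫⁻ ω in (openConn (0 : Site 3) ![(r : ℤ), (r : ℤ), 0] ∩
            openConn (![(r : ℤ), 0, (r : ℤ)] : Site 3) ![0, (r : ℤ), (r : ℤ)] ∩
            (openConn (0 : Site 3) ![(r : ℤ), 0, (r : ℤ)])ᶜ),
          (∑' e : Sym2 (Site 3),
            ({e | e ∈ (zdGraph 3).edgeSet ∧ ∃ u v : Site 3, e = s(u, v) ∧ u ∈ openCluster ω 0 ∧
                v ∈ openCluster ω ![(r : ℤ), 0, (r : ℤ)]} : Set (Sym2 (Site 3))).indicator
              (fun _ => (1 : ENNReal)) e) ^ 2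
          ∂(bondPercolation (zdGraph 3) (criticalProbI 3))) *
        ENNReal.ofReal (tau 3 (criticalProbI 3) 0 ![(r : ℤ), (r : ℤ), 0] *
          tau 3 (criticalProbI 3) ![(r : ℤ), 0, (r : ℤ)] ![0, (r : ℤ), (r : ℤ)]) ≤
      C * (∫⁻ ω in (openConn (0 : Site 3) ![(r : ℤ), (r : ℤ), 0] ∩
            openConn (![(r : ℤ), 0, (r : ℤ)] : Site 3) ![0, (r : ℤ), (r : ℤ)] ∩
            (openConn (0 : Site 3) ![(r : ℤ), 0, (r : ℤ)])ᶜ),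
          (∑' e : Sym2 (Site 3),
            ({e | e ∈ (zdGraph 3).edgeSet ∧ ∃ u v : Site 3, e = s(u, v) ∧ u ∈ openCluster ω 0 ∧
                v ∈ openCluster ω ![(r : ℤ), 0, (r : ℤ)]} : Set (Sym2 (Site 3))).indicator
              (fun _ => (1 : ENNReal)) e)
          ∂(bondPercolation (zdGraph 3) (criticalProbI 3))) ^ 2 ∧
      (∫⁻ ω in (openConn (0 : Site 3) ![(r : ℤ), (r : ℤ), 0] ∩
            openConn (![(r : ℤ), 0, (r : ℤ)] : Site 3) ![0, (r : ℤ), (r : ℤ)] ∩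
            (openConn (0 : Site 3) ![(r : ℤ), 0, (r : ℤ)])ᶜ),
          (∑' e : Sym2 (Site 3),
            ({e | e ∈ (zdGraph 3).edgeSet ∧ ∃ u v : Site 3, e = s(u, v) ∧ u ∈ openCluster ω 0 ∧
                v ∈ openCluster ω ![(r : ℤ), 0, (r : ℤ)]} : Set (Sym2 (Site 3))).indicator
              (fun _ => (1 : ENNReal)) e)
          ∂(bondPercolation (zdGraph 3) (criticalProbI 3))) ≠ ⊤ ∧
      (∫⁻ ω in (openConn (0 : Site 3) ![(r : ℤ), (r : ℤ), 0] ∩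
            openConn (![(r : ℤ), 0, (r : ℤ)] : Site 3) ![0, (r : ℤ), (r : ℤ)] ∩
            (openConn (0 : Site 3) ![(r : ℤ), 0, (r : ℤ)])ᶜ),
          (∑' e : Sym2 (Site 3),
            ({e | e ∈ (zdGraph 3).edgeSet ∧ ∃ u v : Site 3, e = s(u, v) ∧ u ∈ openCluster ω 0 ∧
                v ∈ openCluster ω ![(r : ℤ), 0, (r : ℤ)]} : Set (Sym2 (Site 3))).indicator
              (fun _ => (1 : ENNReal)) e)
          ∂(bondPercolation (zdGraph 3) (criticalProbI 3))) ≠ 0) :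
    Theses.PercTreeValue.TetrahedronDisjointCoexistence := by
  unfold Summit.CriticalPhenomena.PercolationContinuityZ3.Theses.PercTreeValue.TetrahedronDisjointCoexistence
  obtain ⟨δ, hδ, r₀, h⟩ := seamCS_crux_of_moments hCS
    (fun r => mul_nonneg (tau_nonneg _ _ _) (tau_nonneg _ _ _))
    (fun r => (seamCS_measurable_seamCount _ _ _).aemeasurable)
  exact ⟨δ, hδ, r₀, fun r hr => by rw [mul_assoc]; exact h r hr⟩

end Summit.CriticalPhenomena.PercolationContinuityZ3.Theorems.TetrahedronDisjointCoexistence
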